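import Mathlib
import HarnessLib
import Literature.MathematicalPhysics.StatisticalMechanics.PolymerNorms
import Summits.HubbardSuperconductivity.HubbardSuperconductivity.Theorems.ComplexGFFStiffnessHypACumulantHolomorphicCoeffNorm

/-!
# Crux `HypACumulant`, line `gnv` — polymer-norm Lipschitz / parallelogram bounds from HOLOMORPHIC TAYLOR
# COEFFICIENTS (`WeakNormLE` / `MidNormLE` forms of `…HolomorphicCoeffNorm`)

Route `route-HubbardSuperconductivity-ComplexGFFStiffness`, cruxes stmt-HubbardSuperconductivity-19154 /
-19155, shared research statement `OnePointLipschitz`, census (C3d′) (memo §7–§8).  For a family of polymer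
activities `K_σ(X, ·)` (resp. `K_{σ,τ}`) that are `C^{r₀}` for each parameter, whose lifted Taylor coefficients
at every polymer are holomorphic in the parameter(s) on the disc (bidisc), a uniform bound in the weak or
intermediate polymer norm ([ABKM19] (6.48)–(6.50)) gives the Lipschitz bound `(r₀+1)(2C/R)|σ|` and the
parallelogram bound `(r₀+1)(4C/R²)|σ||τ|` in the same norm.  Pure bookkeeping; all proved, no `sorry`.

## References
* S. Adams, S. Buchholz, R. Kotecký, S. Müller, arXiv:1910.13564, Ch. 6.4 (6.48)–(6.50)
  [AdamsBuchholzKoteckyMuller2019].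
-/

noncomputable section

-- `Summit.<Summit>.<Problem>`: single-conjunct summit, the duplicate component is mandated (D-0017).
set_option linter.dupNamespace false

namespace Summit.HubbardSuperconductivity.HubbardSuperconductivity.Theorems.ComplexGFF

open Metric Set
open Literature.MathematicalPhysics.StatisticalMechanics.GradientRG
open Literature.MathematicalPhysics.StatisticalMechanics.TorusPolymer (IsPolymer)
open Literature.Barriers.CriticalPhenomena.LongRangePhi4.Polymer (IsConn)

variable {d M : ℕ} [NeZero M]

/-- **Weak polymer norm, Lipschitz along a one-parameter family with holomorphic coefficients.** -/
theorem weakNormLE_sub_of_holomorphic_coeff (P : NormParams d M) (k : ℕ)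
    {K : ℂ → Finset (Fin d → ZMod M) → ((Fin d → ZMod M) → ℝ) → ℂ} {R C : ℝ}
    (hKc : ∀ σ X, ContDiff ℝ (P.r₀ : WithTop ℕ∞) (gaugeLift (P.gauge k X) (K σ X)))
    (hcoef : ∀ X φ, ∀ s : ℕ, s ≤ P.r₀ → ∀ v : Fin s → LinearMap.range (P.gauge k X),
      DifferentiableOn ℂ (fun σ => iteratedFDeriv ℝ s (gaugeLift (P.gauge k X) (K σ X))
        ((P.gauge k X).rangeRestrict φ) v) (ball (0 : ℂ) R))
    (hC : ∀ σ ∈ ball (0 : ℂ) R, WeakNormLE P k (K σ) C) {σ : ℂ} (hσ : σ ∈ ball (0 : ℂ) R) :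
    WeakNormLE P k (fun X ψ => K σ X ψ - K 0 X ψ) (((P.r₀ : ℝ) + 1) * (2 * C / R) * ‖σ‖) := by
  intro X hX hXc φ
  have h := tayNorm_sub_le_of_holomorphic_coeff (P.gauge k X) P.r₀ (K := fun σ ψ => K σ X ψ)
    (M := C * P.aFactor k X * P.W.weight k X φ) (fun σ' => hKc σ' X) φ (hcoef X φ)
    (fun σ' hσ' => by have := hC σ' hσ' X hX hXc φ; simpa [mul_assoc] using this) hσ
  calc tayNorm (P.gauge k X) P.r₀ (fun ψ => K σ X ψ - K 0 X ψ) φ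
      ≤ ((P.r₀ : ℝ) + 1) * (2 * (C * P.aFactor k X * P.W.weight k X φ) / R) * ‖σ‖ := h
    _ = ((P.r₀ : ℝ) + 1) * (2 * C / R) * ‖σ‖ * P.aFactor k X * P.W.weight k X φ := by ring

/-- **Weak polymer norm, parallelogram along a two-parameter family with holomorphic coefficients.** -/
theorem weakNormLE_secondDiff_of_holomorphic_coeff (P : NormParams d M) (k : ℕ)
    {K : ℂ → ℂ → Finset (Fin d → ZMod M) → ((Fin d → ZMod M) → ℝ) → ℂ} {R C : ℝ}
    (hKc : ∀ σ τ X, ContDiff ℝ (P.r₀ : WithTop ℕ∞) (gaugeLift (P.gauge k X) (K σ τ X)))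
    (hcoefσ : ∀ X φ, ∀ s : ℕ, s ≤ P.r₀ → ∀ v : Fin s → LinearMap.range (P.gauge k X), ∀ τ ∈ ball (0 : ℂ) R,
      DifferentiableOn ℂ (fun σ => iteratedFDeriv ℝ s (gaugeLift (P.gauge k X) (K σ τ X))
        ((P.gauge k X).rangeRestrict φ) v) (ball (0 : ℂ) R))
    (hcoefτ : ∀ X φ, ∀ s : ℕ, s ≤ P.r₀ → ∀ v : Fin s → LinearMap.range (P.gauge k X), ∀ σ ∈ ball (0 : ℂ) R,
      DifferentiableOn ℂ (fun τ => iteratedFDeriv ℝ s (gaugeLift (P.gauge k X) (K σ τ X))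
        ((P.gauge k X).rangeRestrict φ) v) (ball (0 : ℂ) R))
    (hC : ∀ σ ∈ ball (0 : ℂ) R, ∀ τ ∈ ball (0 : ℂ) R, WeakNormLE P k (K σ τ) C)
    {σ τ : ℂ} (hσ : σ ∈ ball (0 : ℂ) R) (hτ : τ ∈ ball (0 : ℂ) R) :
    WeakNormLE P k (fun X ψ => K σ τ X ψ - K σ 0 X ψ - K 0 τ X ψ + K 0 0 X ψ)
      (((P.r₀ : ℝ) + 1) * (4 * C / R ^ 2) * ‖σ‖ * ‖τ‖) := by
  intro X hX hXc φ
  have h := tayNorm_secondDiff_le_of_holomorphic_coeff (P.gauge k X) P.r₀ (K := fun σ τ ψ => K σ τ X ψ)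
    (M := C * P.aFactor k X * P.W.weight k X φ) (fun σ' τ' => hKc σ' τ' X) φ (hcoefσ X φ) (hcoefτ X φ)
    (fun σ' hσ' τ' hτ' => by have := hC σ' hσ' τ' hτ' X hX hXc φ; simpa [mul_assoc] using this) hσ hτ
  calc tayNorm (P.gauge k X) P.r₀ (fun ψ => K σ τ X ψ - K σ 0 X ψ - K 0 τ X ψ + K 0 0 X ψ) φ
      ≤ ((P.r₀ : ℝ) + 1) * (4 * (C * P.aFactor k X * P.W.weight k X φ) / R ^ 2) * ‖σ‖ * ‖τ‖ := h
    _ = ((P.r₀ : ℝ) + 1) * (4 * C / R ^ 2) * ‖σ‖ * ‖τ‖ * P.aFactor k X * P.W.weight k X φ := by ring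

/-- **Intermediate polymer norm `‖·‖_{k:k+1}`, Lipschitz along a family with holomorphic coefficients.** -/
theorem midNormLE_sub_of_holomorphic_coeff (P : NormParams d M) (k : ℕ)
    {K : ℂ → Finset (Fin d → ZMod M) → ((Fin d → ZMod M) → ℝ) → ℂ} {R C : ℝ}
    (hKc : ∀ σ X, ContDiff ℝ (P.r₀ : WithTop ℕ∞) (gaugeLift (P.gauge k X) (K σ X)))
    (hcoef : ∀ X φ, ∀ s : ℕ, s ≤ P.r₀ → ∀ v : Fin s → LinearMap.range (P.gauge k X),
      DifferentiableOn ℂ (fun σ => iteratedFDeriv ℝ s (gaugeLift (P.gauge k X) (K σ X))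
        ((P.gauge k X).rangeRestrict φ) v) (ball (0 : ℂ) R))
    (hC : ∀ σ ∈ ball (0 : ℂ) R, MidNormLE P k (K σ) C) {σ : ℂ} (hσ : σ ∈ ball (0 : ℂ) R) :
    MidNormLE P k (fun X ψ => K σ X ψ - K 0 X ψ) (((P.r₀ : ℝ) + 1) * (2 * C / R) * ‖σ‖) := by
  intro X hX hXc φ
  have h := tayNorm_sub_le_of_holomorphic_coeff (P.gauge k X) P.r₀ (K := fun σ ψ => K σ X ψ)
    (M := C * P.aFactor k X * P.W.midWeight k X φ) (fun σ' => hKc σ' X) φ (hcoef X φ)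
    (fun σ' hσ' => by have := hC σ' hσ' X hX hXc φ; simpa [mul_assoc] using this) hσ
  calc tayNorm (P.gauge k X) P.r₀ (fun ψ => K σ X ψ - K 0 X ψ) φ
      ≤ ((P.r₀ : ℝ) + 1) * (2 * (C * P.aFactor k X * P.W.midWeight k X φ) / R) * ‖σ‖ := h
    _ = ((P.r₀ : ℝ) + 1) * (2 * C / R) * ‖σ‖ * P.aFactor k X * P.W.midWeight k X φ := by ring

/-- **Intermediate polymer norm, parallelogram along a two-parameter family with holomorphic coefficients.** -/
theorem midNormLE_secondDiff_of_holomorphic_coeff (P : NormParams d M) (k : ℕ)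
    {K : ℂ → ℂ → Finset (Fin d → ZMod M) → ((Fin d → ZMod M) → ℝ) → ℂ} {R C : ℝ}
    (hKc : ∀ σ τ X, ContDiff ℝ (P.r₀ : WithTop ℕ∞) (gaugeLift (P.gauge k X) (K σ τ X)))
    (hcoefσ : ∀ X φ, ∀ s : ℕ, s ≤ P.r₀ → ∀ v : Fin s → LinearMap.range (P.gauge k X), ∀ τ ∈ ball (0 : ℂ) R,
      DifferentiableOn ℂ (fun σ => iteratedFDeriv ℝ s (gaugeLift (P.gauge k X) (K σ τ X))
        ((P.gauge k X).rangeRestrict φ) v) (ball (0 : ℂ) R))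
    (hcoefτ : ∀ X φ, ∀ s : ℕ, s ≤ P.r₀ → ∀ v : Fin s → LinearMap.range (P.gauge k X), ∀ σ ∈ ball (0 : ℂ) R,
      DifferentiableOn ℂ (fun τ => iteratedFDeriv ℝ s (gaugeLift (P.gauge k X) (K σ τ X))
        ((P.gauge k X).rangeRestrict φ) v) (ball (0 : ℂ) R))
    (hC : ∀ σ ∈ ball (0 : ℂ) R, ∀ τ ∈ ball (0 : ℂ) R, MidNormLE P k (K σ τ) C)
    {σ τ : ℂ} (hσ : σ ∈ ball (0 : ℂ) R) (hτ : τ ∈ ball (0 : ℂ) R) :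
    MidNormLE P k (fun X ψ => K σ τ X ψ - K σ 0 X ψ - K 0 τ X ψ + K 0 0 X ψ)
      (((P.r₀ : ℝ) + 1) * (4 * C / R ^ 2) * ‖σ‖ * ‖τ‖) := by
  intro X hX hXc φ
  have h := tayNorm_secondDiff_le_of_holomorphic_coeff (P.gauge k X) P.r₀ (K := fun σ τ ψ => K σ τ X ψ)
    (M := C * P.aFactor k X * P.W.midWeight k X φ) (fun σ' τ' => hKc σ' τ' X) φ (hcoefσ X φ) (hcoefτ X φ)
    (fun σ' hσ' τ' hτ' => by have := hC σ' hσ' τ' hτ' X hX hXc φ; simpa [mul_assoc] using this) hσ hτ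
  calc tayNorm (P.gauge k X) P.r₀ (fun ψ => K σ τ X ψ - K σ 0 X ψ - K 0 τ X ψ + K 0 0 X ψ) φ
      ≤ ((P.r₀ : ℝ) + 1) * (4 * (C * P.aFactor k X * P.W.midWeight k X φ) / R ^ 2) * ‖σ‖ * ‖τ‖ := h
    _ = ((P.r₀ : ℝ) + 1) * (4 * C / R ^ 2) * ‖σ‖ * ‖τ‖ * P.aFactor k X * P.W.midWeight k X φ := by ring

end Summit.HubbardSuperconductivity.HubbardSuperconductivity.Theorems.ComplexGFF

end
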